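import Summits.ValiantsHypothesis.ValiantsHypothesis.Theorems.LacunarySymmetroidMatrixDescartesDoorA26WallBubblingConfluentClusters

/-!
# Wall bubbling for `DoorA26` — ONE WEYL PAIR, any face point: THE CONFLUENT CLUSTERS OF A SEQUENCE OF TWENTIES WITHOUT the 2-Sidon hypothesis

LINE / STUBS.  Crux `Theses.LacunarySymmetroid.DoorA26` (stmt-ValiantsHypothesis-19979; OPEN, typed, never asserted), line
`Cruxes/DoorA26/Lines/wall_bubbling.lean` (val-idea-15), obligation (W) `Stmt.stub_weylFaces`; statement file
`Cruxes/DoorA26/Lines/wall_bubbling_ConfluentDoor.lean` rev 5c, stratum `Stmt.weylFaces_wall` with ONE Weyl pair (walls (a)/(b)).  Seat val-sym-door-p2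
g13 (W1 #40).  This is W2's part A `…ConfluentClusters` (door-p1 g15, p674643) VERBATIM with the single use of the generic-face hypothesis `hsid`
(the per-cluster non-degeneracy `confluentDet_ne_zero_of_polar_ne_zero`) replaced by an INPUT `hnd` (every symmetric frame with a non-zero polar Gram
entry has a non-identically-zero confluent determinant at `δ0`) — which W1 #35 `…OnePairWallNondeg` supplies on the one-pair walls (a)/(b):

* `confluentLimit_gram_of_nondeg`, **`confluentClusters_of_nondeg`** — same conclusions as W2's `confluentLimit_gram` / `confluentClusters`: ONE
  subsequence, clusters `c < C` with `Σ_c m c = 20`, drifting centres, recentred zeros in a common window, per-cluster Gram packages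
  `(μ_c, Γ_c = ε_c·polar(W_c,W_c))`, non-degenerate confluent limits and C^∞ convergence — the inputs of W2's rungs (`…ClusterRungs`) and of the
  count, now available OFF the generic face.

USE: W1 #41 `…OnePairWallChain` — the rungs + `chain_ceiling` with `|V| ≤ 14` give `20 ≤ 19`: NO accumulation of twenties at a one-pair wall point AT
ALL (both branches).  No new definitions; nothing here bears on `DoorA26`, `MatrixDescartes` (stmt-ValiantsHypothesis-18050) or `VP ≠ VNP`.
`--supports stmt-ValiantsHypothesis-19979 --as helper`.  [folklore] diagonal subsequences.  [this work = W2's, re-keyed] the packaging.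
-/

-- `Summit.ValiantsHypothesis.ValiantsHypothesis.…` repeats a component by the D-0017 layout
-- (single-conjunct summit), which the `dupNamespace` linter flags; the name is mandated.
set_option linter.dupNamespace false

namespace Summit.ValiantsHypothesis.ValiantsHypothesis.Theorems.LacunarySymmetroidMatrixDescartes.WallBubbling

open Finset Filter Topology Polynomial
open Bubbling (polar Realisable polar_comm polar_self det_sum_smul_fin_two realisable_polarGram realisable_smul realisable_of_tendsto blocks)
open scoped BigOperators

/-! ## 1. The confluent limit with the Gram normalisation exposed (non-degeneracy as input) -/

/-- **THE CONFLUENT LIMIT OF A CLUSTER, WITH ITS GRAM NORMALISATION** (= #15 `confluentLimit`, outputs widened).  For a sequence of genuine `(2,6)`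
pencils `t ↦ det Σ_l e^{δ^ν_l t}U^ν_l` (not identically zero) whose exponents converge to a generic Weyl face (`δ0 5 = δ0 0`, `δ0 ∘ castSucc` 2-Sidon):
along a subsequence `φ`, the sup-normalisation `μ_k > 0` of the polar Gram entries of the CONFLUENT FRAME `(U₀+U₅, U₁, …, U₄, (δ₅−δ₀)U₅)` dominates
them, the normalised entries converge to `Γ = ε · polar(W, W)` (`ε = ±1`, symmetric `W`), the confluent determinant of `W` is not identically zero, and
`ε μ_k⁻¹ · f` converges continuously with all derivatives to it along every further subsequence. [this work] -/
theorem confluentLimit_gram_of_nondeg (δs : ℕ → Fin 6 → ℝ) (δ0 : Fin 6 → ℝ)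
    (hδ : ∀ l, Tendsto (fun ν => δs ν l) atTop (𝓝 (δ0 l))) (h05 : δ0 5 = δ0 0)
    (hnd : ∀ W : Fin 6 → Matrix (Fin 2) (Fin 2) ℝ, (∀ l, (W l).IsSymm) → (∃ p q, polar (W p) (W q) ≠ 0) →
      ∃ t, ((Real.exp (δ0 0 * t)) • (W 0 + t • W 5) + ∑ k : Fin 4, (Real.exp (δ0 k.succ.castSucc * t)) • W k.succ.castSucc).det ≠ 0)
    (U : ℕ → Fin 6 → Matrix (Fin 2) (Fin 2) ℝ) (hU : ∀ ν l, (U ν l).IsSymm)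
    (hne : ∀ ν, ∃ t, (∑ l, Real.exp (δs ν l * t) • U ν l).det ≠ 0) :
    ∃ φ : ℕ → ℕ, StrictMono φ ∧
    ∃ (μ : ℕ → ℝ) (Γ : Fin 6 → Fin 6 → ℝ) (ε : ℝ) (W : Fin 6 → Matrix (Fin 2) (Fin 2) ℝ),
      (∀ k, 0 < μ k) ∧
      (∀ k a b, |polar (if a = 0 then U (φ k) 0 + U (φ k) 5 else if a = 5 then (δs (φ k) 5 - δs (φ k) 0) • U (φ k) 5 else U (φ k) a)
        (if b = 0 then U (φ k) 0 + U (φ k) 5 else if b = 5 then (δs (φ k) 5 - δs (φ k) 0) • U (φ k) 5 else U (φ k) b)| ≤ μ k) ∧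
      (∀ a b, Tendsto (fun k => polar
        (if a = 0 then U (φ k) 0 + U (φ k) 5 else if a = 5 then (δs (φ k) 5 - δs (φ k) 0) • U (φ k) 5 else U (φ k) a)
        (if b = 0 then U (φ k) 0 + U (φ k) 5 else if b = 5 then (δs (φ k) 5 - δs (φ k) 0) • U (φ k) 5 else U (φ k) b) / μ k)
        atTop (𝓝 (Γ a b))) ∧
      (ε = 1 ∨ ε = -1) ∧ (∀ l, (W l).IsSymm) ∧ (∀ a b, Γ a b = ε * polar (W a) (W b)) ∧
      (∃ t, ((Real.exp (δ0 0 * t)) • (W 0 + t • W 5) + ∑ k : Fin 4, (Real.exp (δ0 k.succ.castSucc * t)) • W k.succ.castSucc).det ≠ 0) ∧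
      ∀ (n : ℕ) (ψ : ℕ → ℕ), StrictMono ψ → ∀ (ts : ℕ → ℝ) (t₀ : ℝ), Tendsto ts atTop (𝓝 t₀) →
        Tendsto (fun k => iteratedDeriv n
            (fun t => ε * (μ (ψ k))⁻¹ * (∑ l, Real.exp (δs (φ (ψ k)) l * t) • U (φ (ψ k)) l).det) (ts k))
          atTop (𝓝 (iteratedDeriv n
            (fun t => ((Real.exp (δ0 0 * t)) • (W 0 + t • W 5)
              + ∑ k : Fin 4, (Real.exp (δ0 k.succ.castSucc * t)) • W k.succ.castSucc).det) t₀)) := by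
  classical
  -- the frames, their polar Gram entries and the Gram normalisation
  set V : ℕ → Fin 6 → Matrix (Fin 2) (Fin 2) ℝ := fun ν l =>
    if l = 0 then U ν 0 + U ν 5 else if l = 5 then (δs ν 5 - δs ν 0) • U ν 5 else U ν l with hV
  set M : ℕ → Fin 6 × Fin 6 → ℝ := fun ν pq => polar (V ν pq.1) (V ν pq.2) with hM
  set μ : ℕ → ℝ := fun ν => (univ : Finset (Fin 6 × Fin 6)).sup' (Finset.univ_nonempty) (fun pq => |M ν pq|) with hμ
  have hdom : ∀ ν pq, |M ν pq| ≤ μ ν := fun ν pq => Finset.le_sup' (fun pq => |M ν pq|) (Finset.mem_univ pq)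
  have hatt : ∀ ν, ∃ pq, |M ν pq| = μ ν := by
    intro ν
    obtain ⟨pq, _, hpq⟩ := Finset.exists_mem_eq_sup' (Finset.univ_nonempty (α := Fin 6 × Fin 6)) (fun pq => |M ν pq|)
    exact ⟨pq, hpq.symm⟩
  -- the frame identity at stage ν
  have hframe : ∀ ν t, (∑ l, Real.exp (δs ν l * t) • U ν l).det
      = ∑ p, ∑ q, M ν (p, q) * ((if p = 5 then dslope (fun y : ℝ => Real.exp (y * t)) (δs ν 0) (δs ν 5) else Real.exp (δs ν p * t)) *
          (if q = 5 then dslope (fun y : ℝ => Real.exp (y * t)) (δs ν 0) (δs ν 5) else Real.exp (δs ν q * t))) := by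
    intro ν t
    rw [frame_det]
  have hμpos : ∀ ν, 0 < μ ν := by
    intro ν
    obtain ⟨t, ht⟩ := hne ν
    rw [hframe ν t] at ht
    obtain ⟨p, _, hp⟩ := Finset.exists_ne_zero_of_sum_ne_zero ht
    obtain ⟨q, _, hq⟩ := Finset.exists_ne_zero_of_sum_ne_zero hp
    have hM0 : M ν (p, q) ≠ 0 := fun h => hq (by rw [h, zero_mul])
    exact lt_of_lt_of_le (abs_pos.mpr hM0) (hdom ν (p, q))
  -- one compactness extraction
  obtain ⟨φ, hφ, c, hc, -, hc1⟩ := levelSelection_multi M μ hμpos hdom hatt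
  -- the limit Gram matrix is realisable
  have hreal : Realisable (Matrix.of fun p q => c (p, q)) := by
    refine realisable_of_tendsto (Gseq := fun k => (μ (φ k))⁻¹ • Matrix.of fun p q => M (φ k) (p, q)) ?_ ?_
    · intro k
      exact realisable_smul _ (realisable_polarGram (V (φ k)) (fun l => frame_isSymm (δs (φ k)) (U (φ k)) (hU (φ k)) l))
    · refine tendsto_pi_nhds.mpr fun p => tendsto_pi_nhds.mpr fun q => ?_
      have := hc (p, q)
      simp only [Matrix.smul_apply, Matrix.of_apply, smul_eq_mul]
      simpa [div_eq_inv_mul] using this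
  obtain ⟨ε, W, hε, hW, hGW⟩ := hreal
  have hε2 : ε * ε = 1 := by rcases hε with rfl | rfl <;> norm_num
  -- limit entries in terms of the realising letters
  have hcW : ∀ p q, ε * c (p, q) = polar (W p) (W q) := by
    intro p q
    have := hGW p q
    simp only [Matrix.of_apply] at this
    rw [this, ← mul_assoc, hε2, one_mul]
  have hcW' : ∀ p q, c (p, q) = ε * polar (W p) (W q) := by
    intro p q
    rw [← hcW, ← mul_assoc, hε2, one_mul]
  -- some polar entry of `W` is non-zero
  have hWne : ∃ p q, polar (W p) (W q) ≠ 0 := by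
    obtain ⟨⟨p, q⟩, hpq⟩ := hc1
    refine ⟨p, q, ?_⟩
    rw [← hcW]
    intro h
    rcases mul_eq_zero.mp h with h1 | h1
    · rcases hε with rfl | rfl <;> norm_num at h1
    · rw [h1, abs_zero] at hpq; norm_num at hpq
  refine ⟨φ, hφ, fun k => μ (φ k), fun a b => c (a, b), ε, W, fun k => hμpos (φ k), fun k a b => hdom (φ k) (a, b),
    fun a b => hc (a, b), hε, hW, hcW', hnd W hW hWne, ?_⟩
  -- continuous convergence with all derivatives
  intro n ψ hψ ts t₀ hts
  have hφψ : Tendsto (fun k => φ (ψ k)) atTop atTop := hφ.tendsto_atTop.comp hψ.tendsto_atTop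
  -- rewrite approximants and limit as quadratic forms
  have happrox : ∀ k, (fun t => ε * (μ (φ (ψ k)))⁻¹ * (∑ l, Real.exp (δs (φ (ψ k)) l * t) • U (φ (ψ k)) l).det)
      = fun t => ∑ p, ∑ q, (ε * (M (φ (ψ k)) (p, q) / μ (φ (ψ k)))) *
          ((if p = 5 then dslope (fun y : ℝ => Real.exp (y * t)) (δs (φ (ψ k)) 0) (δs (φ (ψ k)) 5) else Real.exp (δs (φ (ψ k)) p * t)) *
            (if q = 5 then dslope (fun y : ℝ => Real.exp (y * t)) (δs (φ (ψ k)) 0) (δs (φ (ψ k)) 5) else Real.exp (δs (φ (ψ k)) q * t))) := by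
    intro k; funext t
    rw [hframe, Finset.mul_sum]
    refine Finset.sum_congr rfl fun p _ => ?_
    rw [Finset.mul_sum]
    refine Finset.sum_congr rfl fun q _ => ?_
    rw [div_eq_mul_inv]; ring
  have hlimit : (fun t => ((Real.exp (δ0 0 * t)) • (W 0 + t • W 5) + ∑ k : Fin 4, (Real.exp (δ0 k.succ.castSucc * t)) • W k.succ.castSucc).det)
      = fun t => ∑ p, ∑ q, polar (W p) (W q) *
          ((if p = 5 then dslope (fun y : ℝ => Real.exp (y * t)) (δ0 0) (δ0 0) else Real.exp (δ0 p * t)) *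
            (if q = 5 then dslope (fun y : ℝ => Real.exp (y * t)) (δ0 0) (δ0 0) else Real.exp (δ0 q * t))) := by
    funext t; exact confluentDet_eq_quadForm δ0 W t
  rw [hlimit]
  simp only [happrox]
  -- apply the Leibniz bookkeeping of `…ConfluentFrame`
  refine tendsto_iteratedDeriv_quadForm (ι := Fin 6)
    (fun k p q => ε * (M (φ (ψ k)) (p, q) / μ (φ (ψ k))))
    (fun p q => polar (W p) (W q))
    (fun k p t => if p = 5 then dslope (fun y : ℝ => Real.exp (y * t)) (δs (φ (ψ k)) 0) (δs (φ (ψ k)) 5) else Real.exp (δs (φ (ψ k)) p * t))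
    (fun p t => if p = 5 then dslope (fun y : ℝ => Real.exp (y * t)) (δ0 0) (δ0 0) else Real.exp (δ0 p * t))
    ?_ ?_ ts t₀ ?_ ?_ n
  · intro k p m
    by_cases hp : p = 5
    · simp only [hp, if_true]; exact contDiff_dslope_exp _ _ m
    · simp only [hp, if_false]; exact contDiff_exp_const_mul' _ m
  · intro p m
    by_cases hp : p = 5
    · simp only [hp, if_true]; exact contDiff_dslope_exp _ _ m
    · simp only [hp, if_false]; exact contDiff_exp_const_mul' _ m
  · intro p q
    rw [← hcW p q]
    exact ((hc (p, q)).comp hψ.tendsto_atTop).const_mul ε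
  · intro p i
    by_cases hp : p = 5
    · simp only [hp, if_true]
      exact tendsto_iteratedDeriv_dslope_exp i ((hδ 0).comp hφψ) (by rw [← h05]; exact (hδ 5).comp hφψ) hts
    · simp only [hp, if_false]
      exact tendsto_iteratedDeriv_exp i ((hδ p).comp hφψ) hts

/-! ## 2. All clusters at once -/

/-- **THE CONFLUENT CLUSTERS OF A SEQUENCE OF TWENTIES AT A ONE-WEYL-PAIR POINT, non-degeneracy as input** (all clusters along ONE subsequence; W2's `confluentClusters` re-keyed).  See the module docstring.
Conclusions, in order: `Σ_c m c = 20`, every `m c ≥ 1`; the centres of different clusters drift apart; per cluster and stage the `m c` zeros of the letters RECENTRED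
at `s c k` (`e^{δ_l s}U_l`) in the common window `[−R, R]`; and, chosen for all clusters at once, the Gram-normalisation packages of the recentred
letters — `μ_c > 0`
dominating the polar Gram entries of their confluent frame, the limit `Γ_c` of the normalised entries, `Γ_c = ε_c·polar(W_c,W_c)` with `ε_c = ±1` and
symmetric `W_c`, the confluent determinant of `W_c` not identically zero, and continuous convergence with all derivatives of
`ε_c μ_c⁻¹ · det Σ_l e^{δ_l t}(e^{δ_l s_c}U_l)` to it along every further subsequence and every convergent sequence of times. [this work] -/
theorem confluentClusters_of_nondeg (δs : ℕ → Fin 6 → ℝ) (δ0 : Fin 6 → ℝ)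
    (hδ : ∀ l, Tendsto (fun ν => δs ν l) atTop (𝓝 (δ0 l))) (h05 : δ0 5 = δ0 0)
    (hnd : ∀ W : Fin 6 → Matrix (Fin 2) (Fin 2) ℝ, (∀ l, (W l).IsSymm) → (∃ p q, polar (W p) (W q) ≠ 0) →
      ∃ t, ((Real.exp (δ0 0 * t)) • (W 0 + t • W 5) + ∑ k : Fin 4, (Real.exp (δ0 k.succ.castSucc * t)) • W k.succ.castSucc).det ≠ 0)
    (U : ℕ → Fin 6 → Matrix (Fin 2) (Fin 2) ℝ) (hU : ∀ ν l, (U ν l).IsSymm)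
    (hne : ∀ ν, ∃ t, (∑ l, Real.exp (δs ν l * t) • U ν l).det ≠ 0)
    (z : ℕ → Fin 20 → ℝ) (hz : ∀ ν, StrictMono (z ν)) (hroot : ∀ ν i, (∑ l, Real.exp (δs ν l * z ν i) • U ν l).det = 0) :
    ∃ φ : ℕ → ℕ, StrictMono φ ∧
    ∃ (C : ℕ) (m : Fin C → ℕ) (s : Fin C → ℕ → ℝ) (R : ℝ),
      ∑ c, m c = 20 ∧ (∀ c, 1 ≤ m c) ∧
      (∀ c c' : Fin C, c < c' → Tendsto (fun k => s c' k - s c k) atTop atTop) ∧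
      (∀ (c : Fin C) (k : ℕ), ∃ x : Fin (m c) → ℝ, StrictMono x ∧ ∀ i, x i ∈ Set.Icc (-R) R ∧
        (∑ l, Real.exp (δs (φ k) l * x i) • (Real.exp (δs (φ k) l * s c k) • U (φ k) l)).det = 0) ∧
      ∃ (μ : Fin C → ℕ → ℝ) (Γ : Fin C → Fin 6 → Fin 6 → ℝ) (ε : Fin C → ℝ) (W : Fin C → Fin 6 → Matrix (Fin 2) (Fin 2) ℝ),
      ∀ c : Fin C,
        (∀ k, 0 < μ c k) ∧
        (∀ k a b, |polar
          (if a = 0 then Real.exp (δs (φ k) 0 * s c k) • U (φ k) 0 + Real.exp (δs (φ k) 5 * s c k) • U (φ k) 5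
            else if a = 5 then (δs (φ k) 5 - δs (φ k) 0) • (Real.exp (δs (φ k) 5 * s c k) • U (φ k) 5)
            else Real.exp (δs (φ k) a * s c k) • U (φ k) a)
          (if b = 0 then Real.exp (δs (φ k) 0 * s c k) • U (φ k) 0 + Real.exp (δs (φ k) 5 * s c k) • U (φ k) 5
            else if b = 5 then (δs (φ k) 5 - δs (φ k) 0) • (Real.exp (δs (φ k) 5 * s c k) • U (φ k) 5)
            else Real.exp (δs (φ k) b * s c k) • U (φ k) b)| ≤ μ c k) ∧
        (∀ a b, Tendsto (fun k => polar
          (if a = 0 then Real.exp (δs (φ k) 0 * s c k) • U (φ k) 0 + Real.exp (δs (φ k) 5 * s c k) • U (φ k) 5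
            else if a = 5 then (δs (φ k) 5 - δs (φ k) 0) • (Real.exp (δs (φ k) 5 * s c k) • U (φ k) 5)
            else Real.exp (δs (φ k) a * s c k) • U (φ k) a)
          (if b = 0 then Real.exp (δs (φ k) 0 * s c k) • U (φ k) 0 + Real.exp (δs (φ k) 5 * s c k) • U (φ k) 5
            else if b = 5 then (δs (φ k) 5 - δs (φ k) 0) • (Real.exp (δs (φ k) 5 * s c k) • U (φ k) 5)
            else Real.exp (δs (φ k) b * s c k) • U (φ k) b) / μ c k) atTop (𝓝 (Γ c a b))) ∧
        (ε c = 1 ∨ ε c = -1) ∧ (∀ l, (W c l).IsSymm) ∧ (∀ a b, Γ c a b = ε c * polar (W c a) (W c b)) ∧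
        (∃ t, ((Real.exp (δ0 0 * t)) • (W c 0 + t • W c 5)
          + ∑ k : Fin 4, (Real.exp (δ0 k.succ.castSucc * t)) • W c k.succ.castSucc).det ≠ 0) ∧
        ∀ (n : ℕ) (ψ : ℕ → ℕ), StrictMono ψ → ∀ (ts : ℕ → ℝ) (t₀ : ℝ), Tendsto ts atTop (𝓝 t₀) →
          Tendsto (fun k => iteratedDeriv n
              (fun t => ε c * (μ c (ψ k))⁻¹ *
                (∑ l, Real.exp (δs (φ (ψ k)) l * t) • (Real.exp (δs (φ (ψ k)) l * s c (ψ k)) • U (φ (ψ k)) l)).det) (ts k))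
            atTop (𝓝 (iteratedDeriv n
              (fun t => ((Real.exp (δ0 0 * t)) • (W c 0 + t • W c 5)
                + ∑ k : Fin 4, (Real.exp (δ0 k.succ.castSucc * t)) • W c k.succ.castSucc).det) t₀)) := by
  classical
  -- (1) blocks
  obtain ⟨φ₁, hφ₁, C, start, blk, R, hstart, hblk, hwin, hdrift⟩ := blocks z hz
  -- recentred letters at the start of each block, along `φ₁ ∘ χ`
  -- (2) the hereditary per-cluster property
  let P : ℕ → (ℕ → ℕ) → Prop := fun c χ => ∀ hc : c < C,
    ∃ (μ : ℕ → ℝ) (Γ : Fin 6 → Fin 6 → ℝ) (ε : ℝ) (W : Fin 6 → Matrix (Fin 2) (Fin 2) ℝ),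
      (∀ k, 0 < μ k) ∧
      (∀ k a b, |polar
        (if a = 0 then Real.exp (δs (φ₁ (χ k)) 0 * z (φ₁ (χ k)) (start ⟨c, hc⟩)) • U (φ₁ (χ k)) 0
            + Real.exp (δs (φ₁ (χ k)) 5 * z (φ₁ (χ k)) (start ⟨c, hc⟩)) • U (φ₁ (χ k)) 5
          else if a = 5 then (δs (φ₁ (χ k)) 5 - δs (φ₁ (χ k)) 0) •
            (Real.exp (δs (φ₁ (χ k)) 5 * z (φ₁ (χ k)) (start ⟨c, hc⟩)) • U (φ₁ (χ k)) 5)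
          else Real.exp (δs (φ₁ (χ k)) a * z (φ₁ (χ k)) (start ⟨c, hc⟩)) • U (φ₁ (χ k)) a)
        (if b = 0 then Real.exp (δs (φ₁ (χ k)) 0 * z (φ₁ (χ k)) (start ⟨c, hc⟩)) • U (φ₁ (χ k)) 0
            + Real.exp (δs (φ₁ (χ k)) 5 * z (φ₁ (χ k)) (start ⟨c, hc⟩)) • U (φ₁ (χ k)) 5
          else if b = 5 then (δs (φ₁ (χ k)) 5 - δs (φ₁ (χ k)) 0) •
            (Real.exp (δs (φ₁ (χ k)) 5 * z (φ₁ (χ k)) (start ⟨c, hc⟩)) • U (φ₁ (χ k)) 5)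
          else Real.exp (δs (φ₁ (χ k)) b * z (φ₁ (χ k)) (start ⟨c, hc⟩)) • U (φ₁ (χ k)) b)| ≤ μ k) ∧
      (∀ a b, Tendsto (fun k => polar
        (if a = 0 then Real.exp (δs (φ₁ (χ k)) 0 * z (φ₁ (χ k)) (start ⟨c, hc⟩)) • U (φ₁ (χ k)) 0
            + Real.exp (δs (φ₁ (χ k)) 5 * z (φ₁ (χ k)) (start ⟨c, hc⟩)) • U (φ₁ (χ k)) 5
          else if a = 5 then (δs (φ₁ (χ k)) 5 - δs (φ₁ (χ k)) 0) •
            (Real.exp (δs (φ₁ (χ k)) 5 * z (φ₁ (χ k)) (start ⟨c, hc⟩)) • U (φ₁ (χ k)) 5)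
          else Real.exp (δs (φ₁ (χ k)) a * z (φ₁ (χ k)) (start ⟨c, hc⟩)) • U (φ₁ (χ k)) a)
        (if b = 0 then Real.exp (δs (φ₁ (χ k)) 0 * z (φ₁ (χ k)) (start ⟨c, hc⟩)) • U (φ₁ (χ k)) 0
            + Real.exp (δs (φ₁ (χ k)) 5 * z (φ₁ (χ k)) (start ⟨c, hc⟩)) • U (φ₁ (χ k)) 5
          else if b = 5 then (δs (φ₁ (χ k)) 5 - δs (φ₁ (χ k)) 0) •
            (Real.exp (δs (φ₁ (χ k)) 5 * z (φ₁ (χ k)) (start ⟨c, hc⟩)) • U (φ₁ (χ k)) 5)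
          else Real.exp (δs (φ₁ (χ k)) b * z (φ₁ (χ k)) (start ⟨c, hc⟩)) • U (φ₁ (χ k)) b) / μ k) atTop (𝓝 (Γ a b))) ∧
      (ε = 1 ∨ ε = -1) ∧ (∀ l, (W l).IsSymm) ∧ (∀ a b, Γ a b = ε * polar (W a) (W b)) ∧
      (∃ t, ((Real.exp (δ0 0 * t)) • (W 0 + t • W 5) + ∑ k : Fin 4, (Real.exp (δ0 k.succ.castSucc * t)) • W k.succ.castSucc).det ≠ 0) ∧
      ∀ (n : ℕ) (ψ : ℕ → ℕ), StrictMono ψ → ∀ (ts : ℕ → ℝ) (t₀ : ℝ), Tendsto ts atTop (𝓝 t₀) →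
        Tendsto (fun k => iteratedDeriv n
            (fun t => ε * (μ (ψ k))⁻¹ *
              (∑ l, Real.exp (δs (φ₁ (χ (ψ k))) l * t) •
                (Real.exp (δs (φ₁ (χ (ψ k))) l * z (φ₁ (χ (ψ k))) (start ⟨c, hc⟩)) • U (φ₁ (χ (ψ k))) l)).det) (ts k))
          atTop (𝓝 (iteratedDeriv n
            (fun t => ((Real.exp (δ0 0 * t)) • (W 0 + t • W 5)
              + ∑ k : Fin 4, (Real.exp (δ0 k.succ.castSucc * t)) • W k.succ.castSucc).det) t₀))
  have hher : ∀ c (χ ψ : ℕ → ℕ), StrictMono ψ → P c χ → P c (χ ∘ ψ) := by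
    intro c χ ψ hψ hP hc
    obtain ⟨μ, Γ, ε, W, h1, h2, h3, h4, h5, h6, h7, h8⟩ := hP hc
    refine ⟨fun k => μ (ψ k), Γ, ε, W, fun k => h1 (ψ k), fun k a b => h2 (ψ k) a b,
      fun a b => (h3 a b).comp hψ.tendsto_atTop, h4, h5, h6, h7, ?_⟩
    intro n ψ' hψ' ts t₀ hts
    exact h8 n (ψ ∘ ψ') (hψ.comp hψ') ts t₀ hts
  have hatt : ∀ c (χ : ℕ → ℕ), StrictMono χ → ∃ ψ : ℕ → ℕ, StrictMono ψ ∧ P c (χ ∘ ψ) := by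
    intro c χ hχ
    by_cases hc : c < C
    · -- apply `confluentLimit_gram` to the recentred letters along `φ₁ ∘ χ`
      have hχ' : Tendsto (fun ν => φ₁ (χ ν)) atTop atTop := hφ₁.tendsto_atTop.comp hχ.tendsto_atTop
      obtain ⟨ψ, hψ, μ, Γ, ε, W, h1, h2, h3, h4, h5, h6, h7, h8⟩ := confluentLimit_gram_of_nondeg
        (fun ν l => δs (φ₁ (χ ν)) l) δ0 (fun l => (hδ l).comp hχ') h05 hnd
        (fun ν l => Real.exp (δs (φ₁ (χ ν)) l * z (φ₁ (χ ν)) (start ⟨c, hc⟩)) • U (φ₁ (χ ν)) l)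
        (fun ν l => ((hU (φ₁ (χ ν)) l).smul _))
        (by
          intro ν
          obtain ⟨t, ht⟩ := hne (φ₁ (χ ν))
          refine ⟨t - z (φ₁ (χ ν)) (start ⟨c, hc⟩), ?_⟩
          rw [← pencil_recenter, add_sub_cancel]
          exact ht)
      refine ⟨ψ, hψ, fun hc' => ⟨μ, Γ, ε, W, h1, h2, h3, h4, h5, h6, h7, ?_⟩⟩
      intro n ψ' hψ' ts t₀ hts
      exact h8 n ψ' hψ' ts t₀ hts
    · exact ⟨id, strictMono_id, fun hc' => absurd hc' hc⟩
  obtain ⟨χ, hχ, hP⟩ := exists_strictMono_forall_lt C P hher hatt id strictMono_id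
  -- (3) assemble
  have hφ : StrictMono (fun k => φ₁ (χ k)) := hφ₁.comp hχ
  -- cluster sizes
  let m : Fin C → ℕ := fun c => (univ.filter fun j : Fin 20 => blk j = c).card
  have hm : ∑ c, m c = 20 := by
    have := (Finset.card_eq_sum_card_fiberwise (s := (univ : Finset (Fin 20))) (t := (univ : Finset (Fin C))) (f := blk)
      (fun j _ => Finset.mem_univ _)).symm
    rw [Finset.card_univ, Fintype.card_fin] at this
    exact this
  -- every block contains its start: `blk (start c) = c`
  have hblkstart : ∀ c, blk (start c) = c := by
    intro c
    rcases lt_trichotomy (blk (start c)) c with hlt | heq | hgt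
    · exfalso
      -- the start of block `c` stays within `R` of the start of the earlier block `blk (start c)`, yet they drift apart
      have hev := (hdrift _ _ hlt).eventually_gt_atTop R
      obtain ⟨ν, hν⟩ := hev.exists
      have hw := (hwin ν (start c)).2
      exact absurd hw (not_le.mpr hν)
    · exact heq
    · exact absurd (hblk (start c)) (not_le.mpr (hstart hgt))
  have hmpos : ∀ c, 1 ≤ m c := fun c =>
    Finset.card_pos.mpr ⟨start c, Finset.mem_filter.mpr ⟨Finset.mem_univ _, hblkstart c⟩⟩
  refine ⟨fun k => φ₁ (χ k), hφ, C, m, fun c k => z (φ₁ (χ k)) (start c), R, hm, hmpos, ?_, ?_, ?_⟩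
  · -- drift
    intro c c' hcc'
    exact (hdrift c c' hcc').comp hχ.tendsto_atTop
  · -- the zeros of cluster `c` at stage `k`, recentred
    intro c k
    set J : Finset (Fin 20) := univ.filter fun j : Fin 20 => blk j = c with hJ
    have hJcard : J.card = m c := rfl
    let e : Fin (m c) ↪o Fin 20 := J.orderEmbOfFin hJcard
    have heJ : ∀ i, e i ∈ J := fun i => Finset.orderEmbOfFin_mem J hJcard i
    refine ⟨fun i => z (φ₁ (χ k)) (e i) - z (φ₁ (χ k)) (start c), ?_, fun i => ⟨?_, ?_⟩⟩
    · intro i j hij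
      exact sub_lt_sub_right (hz _ (e.strictMono hij)) _
    · have hblkc : blk (e i) = c := (Finset.mem_filter.mp (heJ i)).2
      have := hwin (χ k) (e i)
      rw [hblkc] at this
      exact this
    · rw [← pencil_recenter, add_sub_cancel]
      exact hroot _ _
  · -- the per-cluster packages, chosen simultaneously
    choose μ Γ ε W hpkg using fun c : Fin C => hP c.val c.isLt c.isLt
    exact ⟨μ, Γ, ε, W, hpkg⟩

end Summit.ValiantsHypothesis.ValiantsHypothesis.Theorems.LacunarySymmetroidMatrixDescartes.WallBubbling
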